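import Literature.NumberTheory.LFunctions.XiLadderTailInputs
import Literature.NumberTheory.LFunctions.XiTiltedSecondMoment
import HarnessLib

/-!
# The ladder tail lemma for `ξ`, second-moment row: `μ₂(n) ≤ 3/20` for every `n ≥ 10⁵`, height-free

`Literature/NumberTheory/LFunctions/`. First assembled row of the Jensen track's THEOREM A (eng-3,
LADDER-BL.md; design HOME/jensen/p1/THEOREM-A-ASSEMBLY.md): for every `n ≥ 10⁵` the normalised
variance coordinate `μ₂(n) = xiMu n 2` of the tilted law `ν_{2n} ∝ u^{2n}Φ(u)du` satisfies
`μ₂(n) ≤ 3/20` — the `μ₂`-face of the ladder box `B₄(3/20, 1/141)` of `JensenXiLadderBox.lean`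
(`xiMu_two_le_three_twentieth`). No zero of `ζ`, no numerical enclosure and no named fact enters:
the ingredients are Brascamp–Lieb on the half-line (`XiTiltedSecondMoment.xiMu_two_le_of_curvature`),
the mode bracket and left-mass bound (`XiLadderTailInputs.lean`, built on `XiTiltedNormaliser`,
`ConvexPotentialTails`, `DeBruijnPhiLogDerivEnvelope`, `DeBruijnPhiLogConcave`) and crude rational
bounds for `exp` at five points.

Design (cell-free; all `n ≥ 10⁵` at once): mode `a ≥ α₀ = 17/8` (since
`4πe^{17/2} − 9 < 2·10⁵/α₀`), cut `b = a − 1/40`, bulk floor `R = 16πe^{4(a−1/40)} ≥ 14.4πe^{4a}`,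
left floor `16π`, window `s = 1/80` with ceiling `Λ = 2n/(a−s)² + 16πe^{4(a+s)}(1+10⁻⁶)`,
`−R/3200 + Λ/12800 ≤ −45`, left mass `P ≤ e^{−45}·1600/R`, `B = (1 + 1/5000)/R`, hence
`μ₂ ≤ (1 + 1/5000)·a/(3.6(a − 1/460)²) ≤ 0.1311 ≤ 3/20` at `a ≥ 17/8` (the map `a ↦ a/(a − s)²`
decreases). The printed-constant route of LADDER-BL reaches `n ≥ 10⁴` with `40` cells in `a`; this file
trades the threshold for a one-evaluation proof.

References: Griffin–Ono–Rolen–Zagier, PNAS 116 (2019), Thm 7 / §5.1 [GORZPNAS2019];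
Brascamp–Lieb, J. Funct. Anal. 22 (1976), Thm 4.1 [BrascampLieb1976].
-/

noncomputable section

open MeasureTheory Set Filter
open scoped Topology

namespace Literature.NumberTheory.LFunctions

open Literature.Probability.Distributions

/-! ### Numerical constants -/

/-- `e^8 < 2981`. [folklore] -/
private theorem exp_eight_lt : Real.exp 8 < 2981 := by
  have h := Real.exp_one_lt_d9
  have e : Real.exp 8 = Real.exp 1 ^ 8 := by rw [← Real.exp_nat_mul]; norm_num
  rw [e]
  calc Real.exp 1 ^ 8 < 2.7182818286 ^ 8 := pow_lt_pow_left₀ h (Real.exp_pos 1).le (by norm_num)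
    _ < 2981 := by norm_num

/-- `2980.9 < e^8`. [folklore] -/
private theorem exp_eight_gt : 2980.9 < Real.exp 8 := by
  have h := Real.exp_one_gt_d9
  have e : Real.exp 8 = Real.exp 1 ^ 8 := by rw [← Real.exp_nat_mul]; norm_num
  rw [e]
  calc (2980.9 : ℝ) < 2.7182818283 ^ 8 := by norm_num
    _ < Real.exp 1 ^ 8 := pow_lt_pow_left₀ h (by norm_num) (by norm_num)

/-- `e^{1/2} ≤ 2` (from `1/2 ≤ e^{−1/2}`). [folklore] -/
private theorem exp_half_le_two : Real.exp (1 / 2) ≤ 2 := by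
  have h : -(1 / 2 : ℝ) + 1 ≤ Real.exp (-(1 / 2)) := Real.add_one_le_exp _
  have e : Real.exp (1 / 2) * Real.exp (-(1 / 2)) = 1 := by rw [← Real.exp_add]; norm_num
  nlinarith [Real.exp_pos (1 / 2 : ℝ), Real.exp_pos (-(1 / 2) : ℝ)]

/-- `e^{17/2} < 5962` and `4843 < e^{17/2}`. [folklore] -/
private theorem exp_seventeen_half_bounds : 4843 < Real.exp (17 / 2) ∧ Real.exp (17 / 2) < 5962 := by
  have e : Real.exp (17 / 2) = Real.exp 8 * Real.exp (1 / 2) := by rw [← Real.exp_add]; norm_num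
  rw [e]
  have h1 := exp_eight_lt
  have h2 := exp_eight_gt
  have h3 := exp_half_le_two
  have h4 : (13 : ℝ) / 8 ≤ Real.exp (1 / 2) := by
    have := Real.quadratic_le_exp_of_nonneg (show (0 : ℝ) ≤ 1 / 2 by norm_num)
    linarith
  constructor <;> nlinarith [Real.exp_pos (8 : ℝ), Real.exp_pos (1 / 2 : ℝ)]

/-- `9/10 ≤ e^{−1/10}` and `e^{1/20} ≤ 20/19`. [folklore] -/
private theorem exp_small_bounds : (9 : ℝ) / 10 ≤ Real.exp (-(1 / 10)) ∧ Real.exp (1 / 20) ≤ 20 / 19 := by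
  constructor
  · have h := Real.add_one_le_exp (-(1 / 10) : ℝ); linarith
  · have h : -(1 / 20 : ℝ) + 1 ≤ Real.exp (-(1 / 20)) := Real.add_one_le_exp _
    have e : Real.exp (1 / 20) * Real.exp (-(1 / 20)) = 1 := by rw [← Real.exp_add]; norm_num
    nlinarith [Real.exp_pos (1 / 20 : ℝ), Real.exp_pos (-(1 / 20) : ℝ)]

/-- `e^{−45} ≤ 120/45⁵` (`x⁵/5! ≤ e^x`). [folklore] -/
private theorem exp_neg_45_le : Real.exp (-45) ≤ 120 / 45 ^ 5 := by
  have h := Real.pow_div_factorial_le_exp (45 : ℝ) (by norm_num) 5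
  have h5 : ((Nat.factorial 5 : ℕ) : ℝ) = 120 := by norm_num [Nat.factorial]
  rw [h5] at h
  rw [Real.exp_neg, inv_eq_one_div, div_le_div_iff₀ (Real.exp_pos 45) (by norm_num)]
  linarith

/-- Monotonicity used for uniformity in the mode: `a/(a − s)² ≤ α/(α − s)²` for `0 ≤ s < α ≤ a`.
[folklore] -/
private theorem div_sub_sq_le {a α s : ℝ} (hs0 : 0 ≤ s) (hs : s < α) (ha : α ≤ a) :
    a / (a - s) ^ 2 ≤ α / (α - s) ^ 2 := by
  have h1 : 0 < (a - s) ^ 2 := pow_pos (by linarith) 2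
  have h2 : 0 < (α - s) ^ 2 := pow_pos (by linarith) 2
  rw [div_le_div_iff₀ h1 h2]
  have key : α * (a - s) ^ 2 - a * (α - s) ^ 2 = (a - α) * (a * α - s ^ 2) := by ring
  have hs2 : s ^ 2 ≤ α ^ 2 := pow_le_pow_left₀ hs0 hs.le 2
  have hα2 : α ^ 2 ≤ a * α := by nlinarith
  have h3 : 0 ≤ (a - α) * (a * α - s ^ 2) := mul_nonneg (by linarith) (by linarith)
  linarith

/-! ### The `μ₂` row -/

set_option maxHeartbeats 400000 in
/-- **`μ₂(n) ≤ 3/20` for every `n ≥ 10⁵`, height-free.** The variance coordinate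
`μ₂(n) = m₂(2n)·(2n+1)` of `ν_{2n} ∝ u^{2n}Φ(u)du` is at most `3/20` for all `n ≥ 10⁵`; proof = the
cell-free ladder chain described in the module docstring (mode `≥ 17/8`, Brascamp–Lieb with the bulk
floor `16πe^{4(a − 1/40)}`, negligible left mass). [cite: GORZPNAS2019, Thm 7 and §5.1] -/
theorem xiMu_two_le_three_twentieth (n : ℕ) (hn : 100000 ≤ n) : xiMu n 2 ≤ 3 / 20 := by
  have hπ := Real.pi_gt_d6
  have hπ' := Real.pi_lt_d6
  have hπ0 : 0 < Real.pi := Real.pi_pos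
  obtain ⟨he_lo, he_hi⟩ := exp_seventeen_half_bounds
  obtain ⟨hexp_tenth, hexp_twentieth⟩ := exp_small_bounds
  have hn' : (100000 : ℝ) ≤ n := by exact_mod_cast hn
  -- Step A: the mode `a ≥ 17/8`
  have hcast : ((2 * n : ℕ) : ℝ) = 2 * (n : ℝ) := by push_cast; ring
  have hbr : 4 * Real.pi * Real.exp (4 * (17 / 8 : ℝ)) - 9 < ((2 * n : ℕ) : ℝ) / (17 / 8) := by
    rw [hcast, show (4 : ℝ) * (17 / 8) = 17 / 2 by norm_num]
    have h1 : Real.pi * Real.exp (17 / 2) < 3.141593 * 5962 :=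
      mul_lt_mul'' hπ' he_hi hπ0.le (Real.exp_pos _).le
    have h2 : (76000 : ℝ) ≤ 2 * (n : ℝ) / (17 / 8) := by
      rw [le_div_iff₀ (by norm_num : (0 : ℝ) < 17 / 8)]; linarith
    linarith
  obtain ⟨a, hαa, hmode⟩ := exists_xi_mode_ge (2 * n) (by norm_num : (0 : ℝ) < 17 / 8) hbr
  rw [hcast] at hmode
  have ha : 0 < a := by linarith
  -- `Y = πe^{4a} ≥ 15214`
  set Y : ℝ := Real.pi * Real.exp (4 * a) with hY
  have hY0 : 0 < Y := by positivity
  have hYlo : 15214 ≤ Y := by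
    have h1 : Real.exp (17 / 2) ≤ Real.exp (4 * a) := Real.exp_le_exp.2 (by linarith)
    have h2 : (3.141592 : ℝ) * 4843 ≤ Real.pi * Real.exp (4 * a) :=
      mul_le_mul hπ.le (by linarith) (by norm_num) hπ0.le
    rw [hY]; linarith
  -- the bulk floor `R = 16πe^{4(a − 1/40)} ≥ 14.4·Y`
  set R : ℝ := 16 * Real.pi * Real.exp (4 * (a - 1 / 40)) with hR
  have hRge : (144 / 10) * Y ≤ R := by
    have e1 : Real.exp (4 * (a - 1 / 40)) = Real.exp (4 * a) * Real.exp (-(1 / 10)) := by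
      rw [← Real.exp_add]; congr 1; ring
    have e : R = 16 * Y * Real.exp (-(1 / 10)) := by rw [hR, e1, hY]; ring
    rw [e]
    have := mul_le_mul_of_nonneg_left hexp_tenth (by positivity : (0 : ℝ) ≤ 16 * Y)
    linarith
  have hR0 : 0 < R := by positivity
  have hRlo : 219081 ≤ R := by linarith
  -- `2n ≤ a(4πe^{4a} − 9)`, hence `2n + 1 ≤ 4aY`
  have hkY : 2 * (n : ℝ) + 1 ≤ 4 * a * Y := by
    have henv := neg_deBruijnPhiDeriv_div_le ha.le
    have e : -deBruijnPhiDeriv a / deBruijnPhi a = -(deBruijnPhiDeriv a / deBruijnPhi a) := neg_div _ _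
    have h2 : 2 * (n : ℝ) / a ≤ 4 * Real.pi * Real.exp (4 * a) - 9 := by linarith
    rw [div_le_iff₀ ha] at h2
    have e2 : (4 * Real.pi * Real.exp (4 * a) - 9) * a = 4 * a * Y - 9 * a := by rw [hY]; ring
    rw [e2] at h2
    linarith
  have hk : 2 * (n : ℝ) ≤ 4 * a * Y := by linarith
  -- Step B: floors
  have hfloor : ∀ u : ℝ, 0 < u → a - 1 / 40 ≤ u → R ≤ 2 * (n : ℝ) / u ^ 2 +
      (deBruijnPhiDeriv u ^ 2 - deBruijnPhi u * deBruijnPhiDeriv₂ u) / deBruijnPhi u ^ 2 := by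
    intro u hu hbu
    have h1 := xi_curvature_lower (2 * n) hu
    rw [hcast] at h1
    have h2 : Real.exp (4 * (a - 1 / 40)) ≤ Real.exp (4 * u) := Real.exp_le_exp.2 (by linarith)
    have h3 := mul_le_mul_of_nonneg_left h2 (by positivity : (0 : ℝ) ≤ 16 * Real.pi)
    rw [hR]; linarith
  have hfloor' : ∀ u : ℝ, 0 < u → u < a - 1 / 40 → 16 * Real.pi ≤ 2 * (n : ℝ) / u ^ 2 +
      (deBruijnPhiDeriv u ^ 2 - deBruijnPhi u * deBruijnPhiDeriv₂ u) / deBruijnPhi u ^ 2 := by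
    intro u hu _
    have h1 := xi_curvature_lower (2 * n) hu
    rw [hcast] at h1
    have h2 : (1 : ℝ) ≤ Real.exp (4 * u) := Real.one_le_exp (by linarith)
    have h3 := mul_le_mul_of_nonneg_left h2 (by positivity : (0 : ℝ) ≤ 16 * Real.pi)
    linarith
  -- Step C: the left mass
  have hP := xi_leftMass_le (2 * n) (s := 1 / 80) (τ := 1 / 40) (a := a) (by norm_num) (by norm_num)
    (by linarith) (by linarith) (by rw [hcast]; exact hmode)
  rw [hcast] at hP
  set Λ : ℝ := 2 * (n : ℝ) / (a - 1 / 80) ^ 2 +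
    16 * Real.pi * Real.exp (4 * (a + 1 / 80)) * (1 + 1 / 10 ^ 6) with hΛ
  -- exponent bound: `−R/3200 + Λ/12800 ≤ −45`
  have hΛle : Λ ≤ (188423 / 10000) * Y := by
    have hmon := div_sub_sq_le (s := 1 / 80) (α := 17 / 8) (a := a) (by norm_num) (by norm_num) hαa
    have hpos : 0 < (a - 1 / 80) ^ 2 := pow_pos (by linarith) 2
    have hc : (17 / 8 : ℝ) / (17 / 8 - 1 / 80) ^ 2 ≤ 1 / 2 := by norm_num
    have h1 : 2 * (n : ℝ) / (a - 1 / 80) ^ 2 ≤ 2 * Y := by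
      calc 2 * (n : ℝ) / (a - 1 / 80) ^ 2 ≤ 4 * a * Y / (a - 1 / 80) ^ 2 :=
            div_le_div_of_nonneg_right hk hpos.le
        _ = 4 * Y * (a / (a - 1 / 80) ^ 2) := by ring
        _ ≤ 4 * Y * (1 / 2) := mul_le_mul_of_nonneg_left (hmon.trans hc) (by positivity)
        _ = 2 * Y := by ring
    have h2 : Real.exp (4 * (a + 1 / 80)) ≤ Real.exp (4 * a) * (20 / 19) := by
      have e : Real.exp (4 * (a + 1 / 80)) = Real.exp (4 * a) * Real.exp (1 / 20) := by
        rw [← Real.exp_add]; congr 1; ring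
      rw [e]; exact mul_le_mul_of_nonneg_left hexp_twentieth (Real.exp_pos _).le
    have h3 : 16 * Real.pi * Real.exp (4 * (a + 1 / 80)) * (1 + 1 / 10 ^ 6) ≤
        16 * (20 / 19) * (1 + 1 / 10 ^ 6) * Y := by
      calc 16 * Real.pi * Real.exp (4 * (a + 1 / 80)) * (1 + 1 / 10 ^ 6)
          = 16 * Real.pi * (1 + 1 / 10 ^ 6) * Real.exp (4 * (a + 1 / 80)) := by ring
        _ ≤ 16 * Real.pi * (1 + 1 / 10 ^ 6) * (Real.exp (4 * a) * (20 / 19)) :=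
            mul_le_mul_of_nonneg_left h2 (by positivity)
        _ = 16 * (20 / 19) * (1 + 1 / 10 ^ 6) * Y := by rw [hY]; ring
    have e : Λ = 2 * (n : ℝ) / (a - 1 / 80) ^ 2 +
        16 * Real.pi * Real.exp (4 * (a + 1 / 80)) * (1 + 1 / 10 ^ 6) := hΛ
    rw [e]
    linarith
  have hE : -(R * (1 / 40) ^ 2 / 2) + Λ * (1 / 80) ^ 2 / 2 ≤ -45 := by linarith
  have hexpE : Real.exp (-(R * (1 / 40) ^ 2 / 2)) * Real.exp (Λ * (1 / 80) ^ 2 / 2) ≤ 120 / 45 ^ 5 := by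
    rw [← Real.exp_add]
    exact (Real.exp_le_exp.2 hE).trans exp_neg_45_le
  have hP' : (∫ u in Ioo 0 (a - 1 / 40), deBruijnPhi u * u ^ (2 * n)) / xiMoment (2 * n) ≤
      (120 / 45 ^ 5) * 1600 / R := by
    refine hP.trans ?_
    have hden : 0 < 2 * (1 / 80 : ℝ) * R * (1 / 40) := by positivity
    calc Real.exp (-(R * (1 / 40) ^ 2 / 2)) * Real.exp (Λ * (1 / 80) ^ 2 / 2) /
          (2 * (1 / 80) * R * (1 / 40))
        ≤ (120 / 45 ^ 5) / (2 * (1 / 80) * R * (1 / 40)) := div_le_div_of_nonneg_right hexpE hden.le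
      _ = (120 / 45 ^ 5) * 1600 / R := by field_simp; ring
  -- Step D: `B = (1 + 1/5000)/R`
  set B : ℝ := (1 + 1 / 5000) / R with hB
  have hB0 : 0 < B := by positivity
  have hBineq : R⁻¹ + (16 * Real.pi)⁻¹ *
      ((∫ u in Ioo 0 (a - 1 / 40), deBruijnPhi u * u ^ (2 * n)) / xiMoment (2 * n)) ≤ B := by
    have h1 : (16 * Real.pi)⁻¹ *
        ((∫ u in Ioo 0 (a - 1 / 40), deBruijnPhi u * u ^ (2 * n)) / xiMoment (2 * n)) ≤
        (16 * Real.pi)⁻¹ * ((120 / 45 ^ 5) * 1600 / R) :=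
      mul_le_mul_of_nonneg_left hP' (by positivity)
    have hc : (120 / 45 ^ 5 * 1600 : ℝ) / (16 * Real.pi) ≤ 1 / 5000 := by
      rw [div_le_iff₀ (by positivity)]; norm_num; nlinarith [hπ]
    have h2 : (16 * Real.pi)⁻¹ * ((120 / 45 ^ 5) * 1600 / R) ≤ (1 / 5000) / R := by
      have e : (16 * Real.pi)⁻¹ * ((120 / 45 ^ 5) * 1600 / R) =
          ((120 / 45 ^ 5 * 1600) / (16 * Real.pi)) * R⁻¹ := by
        rw [div_eq_mul_inv _ R, div_eq_mul_inv _ (16 * Real.pi)]; ring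
      rw [e, div_eq_mul_inv (1 / 5000) R]
      exact mul_le_mul_of_nonneg_right hc (inv_nonneg.2 hR0.le)
    have e : B = R⁻¹ + (1 / 5000) / R := by rw [hB]; field_simp
    rw [e]; linarith
  have hBle : B ≤ (1 + 1 / 5000) / 219081 := by
    rw [hB]; exact div_le_div_of_nonneg_left (by norm_num) (by norm_num) hRlo
  have hsqrtB : Real.sqrt B < 1 / 460 := by
    rw [show (1 / 460 : ℝ) = Real.sqrt ((1 / 460) ^ 2) by rw [Real.sqrt_sq (by norm_num)]]
    exact Real.sqrt_lt_sqrt hB0.le (by linarith)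
  have hBa : Real.sqrt B < a := by linarith
  -- the Brascamp–Lieb bound
  obtain ⟨-, hmu⟩ := xiMu_two_le_of_curvature n ha hmode hR0 (by positivity : (0 : ℝ) < 16 * Real.pi)
    hfloor hfloor' hBineq hBa
  -- final numerics: `(2n+1)B/(a − √B)² ≤ (1.0002·a/3.6)/(a − 1/460)² ≤ 3/20`
  have hsB0 : 0 ≤ Real.sqrt B := Real.sqrt_nonneg _
  have hden : (a - 1 / 460) ^ 2 ≤ (a - Real.sqrt B) ^ 2 :=
    pow_le_pow_left₀ (by linarith) (by linarith) 2
  have hdenpos : 0 < (a - 1 / 460) ^ 2 := pow_pos (by linarith) 2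
  have hnumB : (2 * (n : ℝ) + 1) * B ≤ (1 + 1 / 5000) * a / (36 / 10) := by
    have hYne : Y ≠ 0 := hY0.ne'
    calc (2 * (n : ℝ) + 1) * B ≤ (4 * a * Y) * B := mul_le_mul_of_nonneg_right hkY hB0.le
      _ = 4 * a * Y * (1 + 1 / 5000) / R := by rw [hB]; ring
      _ ≤ 4 * a * Y * (1 + 1 / 5000) / ((144 / 10) * Y) :=
          div_le_div_of_nonneg_left (by positivity) (by positivity) hRge
      _ = (1 + 1 / 5000) * a / (36 / 10) := by field_simp; ring
  have hmon := div_sub_sq_le (s := 1 / 460) (α := 17 / 8) (a := a) (by norm_num) (by norm_num) hαa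
  have hcastn : ((2 : ℝ) * n + 1) = 2 * (n : ℝ) + 1 := by ring
  calc xiMu n 2 ≤ (2 * n + 1) * B / (a - Real.sqrt B) ^ 2 := hmu
    _ ≤ (2 * n + 1) * B / (a - 1 / 460) ^ 2 :=
        div_le_div_of_nonneg_left (by positivity) hdenpos hden
    _ ≤ ((1 + 1 / 5000) * a / (36 / 10)) / (a - 1 / 460) ^ 2 :=
        div_le_div_of_nonneg_right hnumB hdenpos.le
    _ = (1 + 1 / 5000) / (36 / 10) * (a / (a - 1 / 460) ^ 2) := by ring
    _ ≤ (1 + 1 / 5000) / (36 / 10) * ((17 / 8) / (17 / 8 - 1 / 460) ^ 2) :=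
        mul_le_mul_of_nonneg_left hmon (by norm_num)
    _ ≤ 3 / 20 := by norm_num

end Literature.NumberTheory.LFunctions
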